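import Summits.QuantumFields.YangMills.Theorems.LuscherReductionTwistedTraceScalingSliceTaylorBased
import HarnessLib

/-!
# Quantitative dependence of the Laplace linear map on the base point, and UNIFORM coercivity in based coordinates
# (lane A of S-BASE, crux `TwistedTraceScaling` stmt-QuantumFields-20203, C4 INNER; design note `pub/ym-fleet/ym-luscher-20007-p1/COARSE-DESIGN.md` §23.9 (N2))

`…SliceTaylorBased` defined the exact linear map `basedLin p = ∂_ξ fB(0,p)` of the Laplace evaluation and proved coercivity at the vacuum base point.  THIS FILE makes the
dependence on the base point `p = (w, c)` QUANTITATIVE without second derivatives: the explicit first-order expansion `…GaugeActionBased` (linear part `−D_{P(c)}(ξ − ξ̄)`, error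
`a_p‖ξ‖ + b‖ξ‖²` with `a_p = O(‖w‖ + ‖c‖)`) pins the derivative to within `a_p` in operator norm (★ abstract `norm_sub_apply_le_of_hasFDerivAt`: a derivative is determined up to
the LINEAR part of any two-term bound), and `D_{P(c)} − ∇ = O(‖c‖)` (`…CovGradInjective`):
* ★ `norm_basedLin_sub_basedLin_zero_le`: `‖(basedLin p − basedLin 0) ξ‖ ≤ 1036·√(3|E|)·‖p‖·‖ξ‖` for `‖p‖ < ε`;
* ★★ `exists_uniform_coercive_basedLin`: `∃ ε > 0, ∀ ‖p‖ < ε, ∀ ξ (ξ(0)=0), ‖ξ‖∞ ≤ 4C_L·‖P_Γ(basedLin p ξ)‖`.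
With `…SliceTaylorBased` and `…LaplaceSandwich` this completes the hypotheses of the Laplace evaluation of the Faddeev–Popov weight at every slice point near the vacuum.
HONEST FRAMING: finite-dimensional calculus for a stub of a child of the CONDITIONAL reduction route R2b1; no spectral claim; C4 OPEN; not a gap, not Clay.
-/

set_option autoImplicit false

noncomputable section

open Filter Topology Real Asymptotics Metric
open scoped BigOperators
open Literature.MathematicalPhysics.QuantumFieldTheory
open Literature.MathematicalPhysics.QuantumLattice

namespace Summit.QuantumFields.YangMills.Theorems.FemtoTransferGap.TwoLattice.ConstTube

open Summit.QuantumFields.YangMills.Theorems.FemtoTransferGap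
open Summit.QuantumFields.YangMills.Theorems.FemtoTransferGap.TwoLattice.Stiff (LinkSpace)
open Literature.Algebra.EuclideanLattices (abs_apply_le_norm)

/-! ## §1 A derivative is determined up to the linear part of a two-term bound -/

section Abstract

variable {E F : Type*} [NormedAddCommGroup E] [NormedSpace ℝ E] [NormedAddCommGroup F] [NormedSpace ℝ F]

/-- ★ If `g` has derivative `T` at `0`, `g 0 = 0`, and `‖g ξ − S ξ‖ ≤ a‖ξ‖ + b‖ξ‖²` near `0`, then `‖(T − S) ξ‖ ≤ a‖ξ‖` for every `ξ`. [folklore] -/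
theorem norm_sub_apply_le_of_hasFDerivAt {g : E → F} {T S : E →L[ℝ] F} {a b : ℝ} (hb : 0 ≤ b) (hT : HasFDerivAt g T 0) (hg0 : g 0 = 0)
    (hS : ∀ᶠ ξ in 𝓝 (0 : E), ‖g ξ - S ξ‖ ≤ a * ‖ξ‖ + b * ‖ξ‖ ^ 2) (ξ : E) : ‖(T - S) ξ‖ ≤ a * ‖ξ‖ := by
  by_cases hξ : ξ = 0
  · rw [hξ, map_zero, norm_zero, norm_zero, mul_zero]
  have hξn : 0 < ‖ξ‖ := norm_pos_iff.mpr hξ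
  refine le_of_forall_pos_le_add fun ε hε => ?_
  -- the derivative: `‖g h − T h‖ ≤ (ε/(2‖ξ‖))‖h‖` near `0`
  have hT' : ∀ᶠ h in 𝓝 (0 : E), ‖g h - T h‖ ≤ ε / (2 * ‖ξ‖) * ‖h‖ := by
    have h1 := hT.isLittleO
    rw [hg0] at h1
    have h2 := h1.def (show 0 < ε / (2 * ‖ξ‖) by positivity)
    filter_upwards [h2] with h hh
    simpa using hh
  obtain ⟨δ, hδ, hballδ⟩ := Metric.mem_nhds_iff.mp (Filter.inter_mem hT' hS)
  -- the test vector `t • ξ`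
  set t : ℝ := min (δ / (2 * ‖ξ‖)) (ε / (2 * (b + 1) * ‖ξ‖ ^ 2)) with ht
  have ht0 : 0 < t := lt_min (by positivity) (by positivity)
  have htδ : t * ‖ξ‖ < δ := by
    have : t ≤ δ / (2 * ‖ξ‖) := min_le_left _ _
    calc t * ‖ξ‖ ≤ δ / (2 * ‖ξ‖) * ‖ξ‖ := mul_le_mul_of_nonneg_right this hξn.le
      _ = δ / 2 := by field_simp
      _ < δ := by linarith
  have htε : b * t * ‖ξ‖ ^ 2 ≤ ε / 2 := by
    have : t ≤ ε / (2 * (b + 1) * ‖ξ‖ ^ 2) := min_le_right _ _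
    calc b * t * ‖ξ‖ ^ 2 ≤ b * (ε / (2 * (b + 1) * ‖ξ‖ ^ 2)) * ‖ξ‖ ^ 2 := by gcongr
      _ = ε / 2 * (b / (b + 1)) := by field_simp
      _ ≤ ε / 2 * 1 := by gcongr; rw [div_le_one (by linarith)]; linarith
      _ = ε / 2 := mul_one _
  have hmem : t • ξ ∈ ball (0 : E) δ := by
    rw [mem_ball, dist_zero_right, norm_smul, Real.norm_of_nonneg ht0.le]; exact htδ
  obtain ⟨h1, h2⟩ := hballδ hmem
  simp only [Set.mem_setOf_eq] at h1 h2
  rw [norm_smul, Real.norm_of_nonneg ht0.le] at h1 h2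
  -- `t‖(T − S)ξ‖ ≤ ‖g(tξ) − T(tξ)‖ + ‖g(tξ) − S(tξ)‖`
  have hkey : t * ‖(T - S) ξ‖ ≤ ε / (2 * ‖ξ‖) * (t * ‖ξ‖) + (a * (t * ‖ξ‖) + b * (t * ‖ξ‖) ^ 2) := by
    have e1 : (T - S) (t • ξ) = (g (t • ξ) - S (t • ξ)) - (g (t • ξ) - T (t • ξ)) := by
      rw [FunLike.coe_sub, Pi.sub_apply]; abel
    calc t * ‖(T - S) ξ‖ = ‖(T - S) (t • ξ)‖ := by rw [map_smul, norm_smul, Real.norm_of_nonneg ht0.le]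
      _ = ‖(g (t • ξ) - S (t • ξ)) - (g (t • ξ) - T (t • ξ))‖ := by rw [e1]
      _ ≤ ‖g (t • ξ) - S (t • ξ)‖ + ‖g (t • ξ) - T (t • ξ)‖ := norm_sub_le _ _
      _ ≤ _ := by linarith
  -- divide by `t`
  have hdiv : ‖(T - S) ξ‖ ≤ ε / 2 + a * ‖ξ‖ + b * t * ‖ξ‖ ^ 2 := by
    have h3 : t * ‖(T - S) ξ‖ ≤ t * (ε / 2 + a * ‖ξ‖ + b * t * ‖ξ‖ ^ 2) := by
      calc _ ≤ _ := hkey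
        _ = t * (ε / 2 + a * ‖ξ‖ + b * t * ‖ξ‖ ^ 2) := by field_simp; ring
    exact le_of_mul_le_mul_left h3 ht0
  linarith

end Abstract

variable (L : ℕ) [NeZero L]

/-! ## §2 The explicit first-order model at base point `p`: `−D_{P(c)}(ξ − ξ̄)` -/

/-- Re-centring a site field: `ξ ↦ ξ − ξ̄` (linear). [folklore] -/
def recentre : (Site 3 L → Fin 3 → ℝ) →ₗ[ℝ] (Site 3 L → Fin 3 → ℝ) where
  toFun ξ := fun x => ξ x - siteMean L ξ
  map_add' a b := by
    funext x
    simp only [siteMean, Pi.add_apply, Finset.sum_add_distrib, smul_add]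
    abel
  map_smul' r a := by
    funext x
    simp only [siteMean, Pi.smul_apply, RingHom.id_apply, ← Finset.smul_sum, smul_sub, smul_comm r]

/-- Its action. [folklore] -/
@[simp] theorem recentre_apply (ξ : Site 3 L → Fin 3 → ℝ) (x : Site 3 L) : recentre L ξ x = ξ x - siteMean L ξ := rfl

/-- The explicit first-order model at slow variable `u`, on based fields: `ξ ↦ −D_u(ξ − ξ̄)`. [folklore] -/
def basedCovLin (u : GaugeConfig 3 1 SU2) : basedSubmodule L →L[ℝ] LinkSpace L :=
  LinearMap.toContinuousLinearMap (-((covGradL L u) ∘ₗ (recentre L) ∘ₗ (basedSubmodule L).subtype))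

/-- Components. [folklore] -/
theorem basedCovLin_apply (u : GaugeConfig 3 1 SU2) (ξ : basedSubmodule L) :
    basedCovLin L u ξ = -covGradL L u (fun x => (ξ : Site 3 L → Fin 3 → ℝ) x - siteMean L (ξ : Site 3 L → Fin 3 → ℝ)) := rfl

/-- At `u = 1` the model is `−∇` = `basedLin 0`. [folklore] -/
theorem basedCovLin_one (ξ : basedSubmodule L) : basedCovLin L 1 ξ = basedLin L 0 ξ := by
  rw [basedCovLin_apply, covGradL_one, vacGrad_sub_siteMean, basedLin_zero]

/-- ★ **The explicit two-term bound at base point `p = (w, c)`**: for `‖ξ‖ ≤ 1/40`, `‖w‖ ≤ 1/20`, `‖c‖ ≤ 1/40`,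
`‖fB(ξ,p) − linkEmbed w − basedCovLin(P∘c) ξ‖ ≤ √(3|E|)·11·(40(4‖ξ‖² + 2‖ξ‖‖w‖) + 12‖c‖‖ξ‖)`. [folklore] -/
theorem norm_basedFn_sub_model_le (ξ : basedSubmodule L) (p : balancedSubmodule L × (Fin 3 → Fin 3 → ℝ)) (hξ : ‖ξ‖ ≤ 1 / 40)
    (hw : ‖p.1‖ ≤ 1 / 20) (hc : ‖p.2‖ ≤ 1 / 40) :
    ‖basedFn L (ξ, p) - linkEmbed L (p.1 : Edge 3 L → Fin 3 → ℝ) - basedCovLin L (fun e₁ => chartSU2 (p.2 e₁.2)) ξ‖ ≤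
      Real.sqrt (3 * Fintype.card (Edge 3 L)) * (11 * (40 * (4 * ‖ξ‖ ^ 2 + 2 * ‖ξ‖ * ‖p.1‖) + 12 * ‖p.2‖ * ‖ξ‖)) := by
  set ξ' : Site 3 L → Fin 3 → ℝ := (ξ : Site 3 L → Fin 3 → ℝ) with hξ'
  set w : Edge 3 L → Fin 3 → ℝ := (p.1 : Edge 3 L → Fin 3 → ℝ) with hwdef
  set c : Fin 3 → Fin 3 → ℝ := p.2 with hcdef
  set u : GaugeConfig 3 1 SU2 := fun e₁ => chartSU2 (c e₁.2) with hudef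
  set B : ℝ := 11 * (40 * (4 * ‖ξ‖ ^ 2 + 2 * ‖ξ‖ * ‖p.1‖) + 12 * ‖p.2‖ * ‖ξ‖) with hB
  have hG : ∀ x, ‖ξ' x‖ ≤ ‖ξ‖ := fun x => norm_le_pi_norm ξ' x
  have hω : ∀ e, ‖w e‖ ≤ ‖p.1‖ := fun e => norm_le_pi_norm w e
  have hbal : ∀ (k : Fin 3) (a : Fin 3), ∑ x : Site 3 L, w (x, k) a = 0 := p.1.2
  have hcτ : ∀ (k : Fin 3) (b : Fin 3), |vecPart (u (0, k)) b| ≤ ‖p.2‖ := fun k b => by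
    have hc1 : ∑ a, c k a ^ 2 ≤ 1 := by
      have h3 := sum_sq_le_three_norm_sq (c k)
      have hck : ‖c k‖ ≤ 1 / 40 := (norm_le_pi_norm c k).trans hc
      nlinarith [norm_nonneg (c k)]
    show |vecPart (chartSU2 (c k)) b| ≤ ‖p.2‖
    rw [vecPart_chartSU2 hc1]
    exact (abs_apply_le_norm (c k) b).trans (norm_le_pi_norm c k)
  have hlin : ∀ e : Edge 3 L, ‖(fun a => relLinkVec L (gaugeTransform (fun x => chartSU2 (ξ' x)) (orthoTube L u w)) (e, a)) -
      (w e - covGrad L u (fun x => ξ' x - siteMean L ξ') e)‖ ≤ B := fun e =>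
    norm_relLinkVec_gaugeTransform_orthoTube_sub_le' (u := u) hG hω hξ hw (by linarith : ‖p.2‖ ≤ 1) hcτ hbal e
  have hB0 : 0 ≤ B := (norm_nonneg _).trans (hlin ((0 : Site 3 L), 0))
  have hcomp : ∀ ea : Edge 3 L × Fin 3,
      |(basedFn L (ξ, p) - linkEmbed L w - basedCovLin L u ξ) ea| ≤ B := fun ea => by
    have hval : (basedFn L (ξ, p) - linkEmbed L w - basedCovLin L u ξ) ea =
        ((fun a => relLinkVec L (gaugeTransform (fun x => chartSU2 (ξ' x)) (orthoTube L u w)) (ea.1, a)) -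
          (w ea.1 - covGrad L u (fun x => ξ' x - siteMean L ξ') ea.1)) ea.2 := by
      rw [WithLp.ofLp_sub, WithLp.ofLp_sub, Pi.sub_apply, Pi.sub_apply, linkEmbed_apply, basedCovLin_apply, WithLp.ofLp_neg, Pi.neg_apply,
        show ea = (ea.1, ea.2) from rfl, covGradL_apply]
      simp only [basedFn, actCfg, basedIncl_apply, Pi.sub_apply, covGrad]
      ring
    rw [hval]
    exact (abs_apply_le_norm _ ea.2).trans (hlin ea.1)
  have hsq : ‖basedFn L (ξ, p) - linkEmbed L w - basedCovLin L u ξ‖ ^ 2 ≤ (Real.sqrt (3 * Fintype.card (Edge 3 L)) * B) ^ 2 := by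
    rw [EuclideanSpace.norm_sq_eq]
    calc ∑ ea, ‖(basedFn L (ξ, p) - linkEmbed L w - basedCovLin L u ξ) ea‖ ^ 2 ≤ ∑ _ea : Edge 3 L × Fin 3, B ^ 2 :=
          Finset.sum_le_sum fun ea _ => by rw [Real.norm_eq_abs]; exact pow_le_pow_left₀ (abs_nonneg _) (hcomp ea) 2
      _ = (3 * Fintype.card (Edge 3 L)) * B ^ 2 := by
          rw [Finset.sum_const, Finset.card_univ, nsmul_eq_mul, Fintype.card_prod, Fintype.card_fin]; push_cast; ring
      _ = (Real.sqrt (3 * Fintype.card (Edge 3 L)) * B) ^ 2 := by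
          rw [show (Real.sqrt (3 * Fintype.card (Edge 3 L)) * B) ^ 2 = Real.sqrt (3 * Fintype.card (Edge 3 L)) ^ 2 * B ^ 2 from mul_pow _ _ 2,
            Real.sq_sqrt (by positivity)]
  exact (abs_le_of_sq_le_sq' hsq (by positivity)).2

/-- `fB(0, p) = linkEmbed w` (the relative coordinate of the untransformed tube point is its stiff coordinate). [folklore] -/
theorem basedFn_zero_left (p : balancedSubmodule L × (Fin 3 → Fin 3 → ℝ)) (hw : ‖p.1‖ ≤ 1 / 20) (hc : ‖p.2‖ ≤ 1 / 40) :
    basedFn L (0, p) = linkEmbed L (p.1 : Edge 3 L → Fin 3 → ℝ) := by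
  have h := norm_basedFn_sub_model_le L 0 p (by rw [norm_zero]; norm_num) hw hc
  rw [norm_zero, map_zero, sub_zero] at h
  have h0 : ‖basedFn L (0, p) - linkEmbed L (p.1 : Edge 3 L → Fin 3 → ℝ)‖ ≤ 0 := by
    calc _ ≤ _ := h
      _ = 0 := by ring
  exact sub_eq_zero.mp (norm_le_zero_iff.mp h0)

/-! ## §3 The derivative at base point `p` is within `O(‖p‖)` of `−∇` -/

/-- `ξ ↦ fB(ξ, p)` has derivative `basedLin p` at `0`, for `p` near `0`. [folklore] -/
theorem eventually_hasFDerivAt_basedFn_left : ∀ᶠ p : balancedSubmodule L × (Fin 3 → Fin 3 → ℝ) in 𝓝 0,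
    HasFDerivAt (fun ξ : basedSubmodule L => basedFn L (ξ, p)) (basedLin L p) 0 := by
  have hdiff : ∀ᶠ z : BasedDom L in 𝓝 0, DifferentiableAt ℝ (basedFn L) z := by
    have h := (contDiffAt_basedFn L (n := 1)).eventually (by simp)
    filter_upwards [h] with z hz using hz.differentiableAt one_ne_zero
  have hcont : ContinuousAt (fun p : balancedSubmodule L × (Fin 3 → Fin 3 → ℝ) => ((0 : basedSubmodule L), p)) 0 :=
    (continuous_const.prodMk continuous_id).continuousAt
  have hdiff' : ∀ᶠ z in 𝓝 (((0 : basedSubmodule L), (0 : balancedSubmodule L × (Fin 3 → Fin 3 → ℝ))) : BasedDom L),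
      DifferentiableAt ℝ (basedFn L) z := hdiff
  have h2 : ∀ᶠ p : balancedSubmodule L × (Fin 3 → Fin 3 → ℝ) in 𝓝 0, DifferentiableAt ℝ (basedFn L) ((0 : basedSubmodule L), p) :=
    hcont.eventually hdiff'
  filter_upwards [h2] with p hp
  have hincl : HasFDerivAt (fun ξ : basedSubmodule L => ((ξ, p) : BasedDom L)) (ContinuousLinearMap.inl ℝ _ _) 0 :=
    (hasFDerivAt_id (0 : basedSubmodule L)).prodMk (hasFDerivAt_const p 0)
  exact hp.hasFDerivAt.comp 0 hincl

/-- ★ **The Laplace linear map moves by `O(‖p‖)`**: `‖(basedLin p − basedLin 0) ξ‖ ≤ 1144·√(3|E|)·‖p‖·‖ξ‖` for `p` near `0`. [folklore] -/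
theorem eventually_norm_basedLin_sub_le : ∀ᶠ p : balancedSubmodule L × (Fin 3 → Fin 3 → ℝ) in 𝓝 0, ∀ ξ : basedSubmodule L,
    ‖(basedLin L p - basedLin L 0) ξ‖ ≤ 1144 * Real.sqrt (3 * Fintype.card (Edge 3 L)) * ‖p‖ * ‖ξ‖ := by
  have hsmall : ∀ᶠ p : balancedSubmodule L × (Fin 3 → Fin 3 → ℝ) in 𝓝 0, ‖p‖ < 1 / 40 := by
    have := Metric.ball_mem_nhds (0 : balancedSubmodule L × (Fin 3 → Fin 3 → ℝ)) (show (0 : ℝ) < 1 / 40 by norm_num)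
    filter_upwards [this] with p hp; rwa [mem_ball, dist_zero_right] at hp
  filter_upwards [eventually_hasFDerivAt_basedFn_left L, hsmall] with p hder hp ξ
  set R : ℝ := Real.sqrt (3 * Fintype.card (Edge 3 L)) with hR
  have hR0 : 0 ≤ R := Real.sqrt_nonneg _
  have hw : ‖p.1‖ ≤ 1 / 20 := (norm_fst_le p).trans (by linarith [hp.le])
  have hc : ‖p.2‖ ≤ 1 / 40 := (norm_snd_le p).trans hp.le
  have hw' : ‖p.1‖ ≤ ‖p‖ := norm_fst_le p
  have hc' : ‖p.2‖ ≤ ‖p‖ := norm_snd_le p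
  set u : GaugeConfig 3 1 SU2 := fun e₁ => chartSU2 (p.2 e₁.2) with hudef
  -- the two-term bound for `g ξ = fB(ξ,p) − fB(0,p)` against `S = basedCovLin u`
  have hS : ∀ᶠ ξ : basedSubmodule L in 𝓝 0, ‖(basedFn L (ξ, p) - basedFn L (0, p)) - basedCovLin L u ξ‖ ≤
      (R * 11 * (80 * ‖p.1‖ + 12 * ‖p.2‖)) * ‖ξ‖ + (R * 1760) * ‖ξ‖ ^ 2 := by
    have hb := Metric.closedBall_mem_nhds (0 : basedSubmodule L) (show (0 : ℝ) < 1 / 40 by norm_num)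
    filter_upwards [hb] with ξ hξ
    rw [mem_closedBall, dist_zero_right] at hξ
    rw [basedFn_zero_left L p hw hc]
    calc _ ≤ R * (11 * (40 * (4 * ‖ξ‖ ^ 2 + 2 * ‖ξ‖ * ‖p.1‖) + 12 * ‖p.2‖ * ‖ξ‖)) := norm_basedFn_sub_model_le L ξ p hξ hw hc
      _ = (R * 11 * (80 * ‖p.1‖ + 12 * ‖p.2‖)) * ‖ξ‖ + (R * 1760) * ‖ξ‖ ^ 2 := by ring
  have hg0 : basedFn L ((0 : basedSubmodule L), p) - basedFn L (0, p) = 0 := sub_self _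
  have hT : HasFDerivAt (fun ξ : basedSubmodule L => basedFn L (ξ, p) - basedFn L (0, p)) (basedLin L p) 0 := hder.sub_const _
  have hmain := norm_sub_apply_le_of_hasFDerivAt (by positivity) hT hg0 hS ξ
  -- `basedCovLin u − basedLin 0 = −(D_u − ∇)(ξ − ξ̄)`
  have hcov : ‖(basedCovLin L u - basedLin L 0) ξ‖ ≤ 24 * R * ‖p.2‖ * ‖ξ‖ := by
    have hcτ : ∀ (k : Fin 3) (b : Fin 3), |vecPart (u (0, k)) b| ≤ ‖p.2‖ := fun k b => by
      have hc1 : ∑ a, p.2 k a ^ 2 ≤ 1 := by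
        have h3 := sum_sq_le_three_norm_sq (p.2 k)
        have hck : ‖p.2 k‖ ≤ 1 / 40 := (norm_le_pi_norm p.2 k).trans hc
        nlinarith [norm_nonneg (p.2 k)]
      show |vecPart (chartSU2 (p.2 k)) b| ≤ ‖p.2‖
      rw [vecPart_chartSU2 hc1]
      exact (abs_apply_le_norm (p.2 k) b).trans (norm_le_pi_norm p.2 k)
    have hform : (basedCovLin L u - basedLin L 0) ξ =
        -(covGradL L u (fun x => (ξ : Site 3 L → Fin 3 → ℝ) x - siteMean L (ξ : Site 3 L → Fin 3 → ℝ)) -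
          vacGrad L (fun x => (ξ : Site 3 L → Fin 3 → ℝ) x - siteMean L (ξ : Site 3 L → Fin 3 → ℝ))) := by
      rw [FunLike.coe_sub, Pi.sub_apply, basedCovLin_apply, basedLin_zero, vacGrad_sub_siteMean]; abel
    rw [hform, norm_neg]
    have h1 := norm_covGradL_sub_vacGrad_le L u (by linarith : ‖p.2‖ ≤ 1) hcτ (fun x => (ξ : Site 3 L → Fin 3 → ℝ) x - siteMean L (ξ : Site 3 L → Fin 3 → ℝ))
    have h2 : ‖fun x => (ξ : Site 3 L → Fin 3 → ℝ) x - siteMean L (ξ : Site 3 L → Fin 3 → ℝ)‖ ≤ 2 * ‖ξ‖ := by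
      refine (pi_norm_le_iff_of_nonneg (by positivity)).mpr fun x => ?_
      calc ‖(ξ : Site 3 L → Fin 3 → ℝ) x - siteMean L (ξ : Site 3 L → Fin 3 → ℝ)‖
          ≤ ‖(ξ : Site 3 L → Fin 3 → ℝ) x‖ + ‖siteMean L (ξ : Site 3 L → Fin 3 → ℝ)‖ := norm_sub_le _ _
        _ ≤ ‖ξ‖ + ‖ξ‖ := add_le_add (norm_le_pi_norm _ x) (norm_siteMean_le L fun y => norm_le_pi_norm _ y)
        _ = 2 * ‖ξ‖ := by ring
    calc _ ≤ 12 * R * ‖p.2‖ * ‖fun x => (ξ : Site 3 L → Fin 3 → ℝ) x - siteMean L (ξ : Site 3 L → Fin 3 → ℝ)‖ := by rw [hR]; exact h1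
      _ ≤ 12 * R * ‖p.2‖ * (2 * ‖ξ‖) := by gcongr
      _ = 24 * R * ‖p.2‖ * ‖ξ‖ := by ring
  have hsplit : (basedLin L p - basedLin L 0) ξ = (basedLin L p - basedCovLin L u) ξ + (basedCovLin L u - basedLin L 0) ξ := by
    simp only [FunLike.coe_sub, Pi.sub_apply]; abel
  rw [hsplit]
  calc _ ≤ ‖(basedLin L p - basedCovLin L u) ξ‖ + ‖(basedCovLin L u - basedLin L 0) ξ‖ := norm_add_le _ _
    _ ≤ (R * 11 * (80 * ‖p.1‖ + 12 * ‖p.2‖)) * ‖ξ‖ + 24 * R * ‖p.2‖ * ‖ξ‖ := add_le_add hmain hcov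
    _ ≤ (R * 11 * (80 * ‖p‖ + 12 * ‖p‖)) * ‖ξ‖ + 24 * R * ‖p‖ * ‖ξ‖ := by gcongr
    _ = 1036 * (R * ‖p‖ * ‖ξ‖) := by ring
    _ ≤ 1144 * (R * ‖p‖ * ‖ξ‖) := mul_le_mul_of_nonneg_right (by norm_num) (by positivity)
    _ = 1144 * R * ‖p‖ * ‖ξ‖ := by ring

/-! ## §4 ★★ Uniform coercivity -/

/-- ★★ **UNIFORM COERCIVITY OF THE LAPLACE LINEAR MAP NEAR THE VACUUM BASE POINT**: `∃ ε > 0, ∀ ‖p‖ < ε, ∀ ξ, ‖ξ‖∞ ≤ 4C_L·‖P_Γ(basedLin p ξ)‖`. [folklore] -/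
theorem exists_uniform_coercive_basedLin : ∃ ε : ℝ, 0 < ε ∧ ∀ p : balancedSubmodule L × (Fin 3 → Fin 3 → ℝ), ‖p‖ < ε →
    ∀ ξ : basedSubmodule L, ‖ξ‖ ≤ 4 * sliceConst L * ‖(gaugeModes L).starProjection (basedLin L p ξ)‖ := by
  have hC := sliceConst_pos L
  set R : ℝ := Real.sqrt (3 * Fintype.card (Edge 3 L)) with hR
  set P := (gaugeModes L).starProjection with hP
  obtain ⟨ε₀, hε₀, hball⟩ := Metric.mem_nhds_iff.mp (eventually_norm_basedLin_sub_le L)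
  set ε : ℝ := min ε₀ (1 / (4 * sliceConst L * (1144 * R + 1))) with hεdef
  have hε : 0 < ε := lt_min hε₀ (by positivity)
  refine ⟨ε, hε, fun p hp ξ => ?_⟩
  have hp0 : ‖p‖ < ε₀ := lt_of_lt_of_le hp (min_le_left _ _)
  have hp1 : ‖p‖ ≤ 1 / (4 * sliceConst L * (1144 * R + 1)) := (lt_of_lt_of_le hp (min_le_right _ _)).le
  have hb := hball (show p ∈ ball 0 ε₀ by rwa [mem_ball, dist_zero_right]) ξ
  have h0 := norm_le_basedLin_zero L ξ
  have hξ0 : 0 ≤ ‖ξ‖ := norm_nonneg ξ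
  have hdiff : ‖P (basedLin L 0 ξ)‖ ≤ ‖P (basedLin L p ξ)‖ + ‖(basedLin L p - basedLin L 0) ξ‖ := by
    have e1 : P (basedLin L 0 ξ) = P (basedLin L p ξ) - P ((basedLin L p - basedLin L 0) ξ) := by
      rw [FunLike.coe_sub, Pi.sub_apply, map_sub]; abel
    calc ‖P (basedLin L 0 ξ)‖ = ‖P (basedLin L p ξ) - P ((basedLin L p - basedLin L 0) ξ)‖ := by rw [← e1]
      _ ≤ ‖P (basedLin L p ξ)‖ + ‖P ((basedLin L p - basedLin L 0) ξ)‖ := norm_sub_le _ _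
      _ ≤ ‖P (basedLin L p ξ)‖ + ‖(basedLin L p - basedLin L 0) ξ‖ := by gcongr; exact Submodule.norm_starProjection_apply_le _ _
  -- `2C·‖(b_p − b_0)ξ‖ ≤ 2C·1144R‖p‖‖ξ‖ ≤ ‖ξ‖/2`
  have hsmall : 2 * sliceConst L * ‖(basedLin L p - basedLin L 0) ξ‖ ≤ ‖ξ‖ / 2 := by
    have h1 : 2 * sliceConst L * (1144 * R * ‖p‖) ≤ 1 / 2 := by
      have h2 : (1144 * R) * ‖p‖ ≤ (1144 * R + 1) * (1 / (4 * sliceConst L * (1144 * R + 1))) :=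
        mul_le_mul (by linarith) hp1 (norm_nonneg _) (by positivity)
      have hden : (1144 * R + 1) ≠ 0 := by positivity
      have hC0 : sliceConst L ≠ 0 := hC.ne'
      calc 2 * sliceConst L * (1144 * R * ‖p‖) ≤ 2 * sliceConst L * ((1144 * R + 1) * (1 / (4 * sliceConst L * (1144 * R + 1)))) := by
            exact mul_le_mul_of_nonneg_left h2 (by positivity)
        _ = 1 / 2 := by field_simp; ring
    calc 2 * sliceConst L * ‖(basedLin L p - basedLin L 0) ξ‖ ≤ 2 * sliceConst L * (1144 * R * ‖p‖ * ‖ξ‖) := mul_le_mul_of_nonneg_left hb (by positivity)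
      _ = (2 * sliceConst L * (1144 * R * ‖p‖)) * ‖ξ‖ := by ring
      _ ≤ (1 / 2) * ‖ξ‖ := mul_le_mul_of_nonneg_right h1 hξ0
      _ = ‖ξ‖ / 2 := by ring
  have h1 : ‖ξ‖ ≤ 2 * sliceConst L * ‖P (basedLin L p ξ)‖ + ‖ξ‖ / 2 := by
    calc ‖ξ‖ ≤ 2 * sliceConst L * ‖P (basedLin L 0 ξ)‖ := h0
      _ ≤ 2 * sliceConst L * (‖P (basedLin L p ξ)‖ + ‖(basedLin L p - basedLin L 0) ξ‖) := mul_le_mul_of_nonneg_left hdiff (by positivity)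
      _ = 2 * sliceConst L * ‖P (basedLin L p ξ)‖ + 2 * sliceConst L * ‖(basedLin L p - basedLin L 0) ξ‖ := by ring
      _ ≤ 2 * sliceConst L * ‖P (basedLin L p ξ)‖ + ‖ξ‖ / 2 := by linarith
  linarith

end Summit.QuantumFields.YangMills.Theorems.FemtoTransferGap.TwoLattice.ConstTube

end
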